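import Summits.QuantumFields.BalabanUV.T4Continuum.Support.NE7K1LinSchurLineDeriv
import Summits.QuantumFields.BalabanUV.T4Continuum.Support.NE7K1LinSchurLineU1

/-!
# NE7K1LinSchurLineDerivRel — row NE7 (node U5), candidate route HOM, path H1L, cell K1-lin(s): the `∂_s` LETTER IN
# FORM-RELATIVE CURRENCY — `‖(G(s) − G(t))g‖ ≤ |t−s|·(K∕(c₁σ))·‖g‖` from the TWO-RUN COMPARABILITY `c₁P₀ ≤ P₁`,
# `|P₁ − P₀| ≤ K·P₀` — and the located fact that the weighted-`ℓ²` letter of `NE7K1LinSchurLineDeriv` is MESH-DEPENDENT at U = 1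

Lineage `b2b-balaban-t4-ne7-p2` (CRUX PROVER NE7 #2), generation 64; ninth piece of the cell.  WHY.  `NE7K1LinSchurLineDeriv`
(p288057 ✓; PRICING-NE7 v16.1 §98 P-v16.1-3 ∕ lens 1 (π1)) bounds `G(s) − G(t) = (t−s)·G(s)(P₁ − P₀)G(t)` in the weighted
`ℓ²` norm with the instantiator's SCHUR-TEST constants `K_{P₀}, K_{A₁}, K_B, K_C` of the four finite-range blocks.  At U = 1
(`NE7K1LinSchurLineU1`: `P₀ = runA = fineOpR n a 0 R = n²(−Δ^N_R) + (a∕n^{d+1})1_{same block}`) these constants are NOT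
mesh-free: §3 `schurTest_runA_ge` — any `K_{P₀}` with `‖P₀w‖² ≤ K_{P₀}²‖w‖²` has `K_{P₀}² ≥ n⁴` as soon as the region has
one nearest-neighbour pair (test `w = δ_x`: the diagonal entry of `fineOpR` at `x` is `n²·deg_R(x) + a∕n^{d+1} ≥ n²`).  So the
`ℓ²` derivative letter degrades like `η^{−4}` in `(t−s)²·(…)`; and WITHOUT a comparison of `P₀` and `P₁` nothing better is
true (scalar model `P₀ = n², P₁ = 1`: `∂_sG(1) = n² − 1`).  The η-UNIFORM `∂_s` letter lives in the FORM-RELATIVE currency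
and needs exactly the two-run comparability `c₁·P₀ ≤ P₁ ≤ C₁·P₀` (a K1-var-type input — X-A6's object — which at A = 0 is
the block-constant trial + Jensen, filed separately).  THIS FILE proves the abstract letter ([folklore], real symmetric matrices):

* §1 `abs_dot_mulVec_le_of_psd` — polarised AM–GM for a symmetric PSD `Q`: `|⟨z,Qu⟩| ≤ ½(λ⟨z,Qz⟩ + λ⁻¹⟨u,Qu⟩)`;
  `abs_dot_mulVec_le_of_squeeze` — if `±D ≤ K·P₀` as forms then `|⟨z,Du⟩| ≤ (K∕2)(λ⟨z,P₀z⟩ + λ⁻¹⟨u,P₀u⟩)`.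
* §2 **`inv_line_sub_inv_line_sq_le`**: `P₀, P₁` symmetric and `σ`-coercive (`σ > 0`), `c₁⟨v,P₀v⟩ ≤ ⟨v,P₁v⟩` (`0 < c₁ ≤ 1`),
  `|⟨v,P₁v⟩ − ⟨v,P₀v⟩| ≤ K⟨v,P₀v⟩` (`K > 0`), `L(r) = (1−r)P₀ + rP₁`: for all `s, t ∈ [0,1]` and every `g`,
  `‖(L(s)⁻¹ − L(t)⁻¹)g‖² ≤ (t−s)²·(K∕(c₁σ))²·‖g‖²` — NO norm of `P₀` or `P₁` enters (mesh-free when `σ, c₁, K` are).  Route: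
  `w := G(s)(P₁−P₀)u`, `u := G(t)g`, `z := G(s)w`; `‖w‖² = ⟨z,(P₁−P₀)u⟩ ≤ (K∕2)(λ⟨z,P₀z⟩ + λ⁻¹⟨u,P₀u⟩)`,
  `⟨z,P₀z⟩ ≤ c₁⁻¹⟨z,L(s)z⟩ = c₁⁻¹⟨z,w⟩ ≤ ‖w‖²∕(c₁σ)`, `⟨u,P₀u⟩ ≤ ‖g‖²∕(c₁σ)`, `λ := c₁σ∕K`;
  **`lineOpR_inv_sub_inv_rel`** = the same for `NE7K1LinSchurLineForm.lineOpR` (`P₁ = A₁ − BD⁻¹C`).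
* §3 **`schurTest_runA_ge`** (the located fact at U = 1, `wN` of `NE7K1LinSchurLineDeriv` at weight `0`).

HONEST FRAMING: [folklore] finite real matrices + one diagonal entry of the tree's `B4Lower18.fineOpR`; the comparability
hypotheses are NOT discharged here; nothing printed asserted; no `sorry`.  FIXED FINITE T⁴, rung (B)+1; NE7 NOT PRINTED ∕ NOT
PROVED; spine 0∕9; NOT infinite volume, NOT mass gap, NOT Clay.  HONEST DEPENDENCY: continuum YM on T⁴ ⇐ BetaPertH ∧ nine
spine estimates (0/9 proved); BetaPertH ⇐ (D1) ∧ (D4) ∧ CAP+tail; G-an2-4 gates asym, D1 and NE2/3/4.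
-/

noncomputable section

open Finset Matrix

namespace Summit.QuantumFields.BalabanUV.T4Continuum.NE7K1LinSchurLineDerivRel

open NE7K1LinSchurLineForm NE7K1LinSchurLineDeriv

/-! ### §1 Polarised form bounds -/

section Abstract

variable {ι : Type*} [Fintype ι]

/-- for a symmetric matrix the bilinear form is symmetric: `⟨u, Qz⟩ = ⟨z, Qu⟩`. [folklore] -/
theorem dot_mulVec_comm_of_isSymm (Q : Matrix ι ι ℝ) (hQ : Q.IsSymm) (u z : ι → ℝ) :
    u ⬝ᵥ Q.mulVec z = z ⬝ᵥ Q.mulVec u := by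
  rw [dotProduct_mulVec, ← mulVec_transpose, hQ.eq, dotProduct_comm]

/-- **POLARISED AM–GM FOR A SYMMETRIC PSD MATRIX**: `|⟨z,Qu⟩| ≤ ½(λ⟨z,Qz⟩ + λ⁻¹⟨u,Qu⟩)` (`λ > 0`). [folklore] -/
theorem abs_dot_mulVec_le_of_psd (Q : Matrix ι ι ℝ) (hQ : Q.IsSymm) (hpsd : ∀ w, 0 ≤ w ⬝ᵥ Q.mulVec w)
    {lam : ℝ} (hlam : 0 < lam) (z u : ι → ℝ) :
    |z ⬝ᵥ Q.mulVec u| ≤ (lam * (z ⬝ᵥ Q.mulVec z) + lam⁻¹ * (u ⬝ᵥ Q.mulVec u)) / 2 := by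
  have hsym := dot_mulVec_comm_of_isSymm Q hQ u z
  have h1 := hpsd (lam • z - u)
  have h2 := hpsd (lam • z + u)
  simp only [sub_dotProduct, dotProduct_sub, add_dotProduct, dotProduct_add, mulVec_sub, mulVec_add, mulVec_smul,
    smul_dotProduct, dotProduct_smul, smul_eq_mul] at h1 h2
  rw [hsym] at h1 h2
  have hl : lam⁻¹ * lam = 1 := inv_mul_cancel₀ hlam.ne'
  rw [abs_le]
  constructor
  · -- from `h2`: `-2λ⟨z,Qu⟩ ≤ λ²⟨z,Qz⟩ + ⟨u,Qu⟩`
    have h2' : -(2 * lam * (z ⬝ᵥ Q.mulVec u)) ≤ lam ^ 2 * (z ⬝ᵥ Q.mulVec z) + u ⬝ᵥ Q.mulVec u := by nlinarith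
    have : -(z ⬝ᵥ Q.mulVec u) ≤ (lam * (z ⬝ᵥ Q.mulVec z) + lam⁻¹ * (u ⬝ᵥ Q.mulVec u)) / 2 := by
      have h3 : lam⁻¹ * (-(2 * lam * (z ⬝ᵥ Q.mulVec u))) ≤ lam⁻¹ * (lam ^ 2 * (z ⬝ᵥ Q.mulVec z) + u ⬝ᵥ Q.mulVec u) :=
        mul_le_mul_of_nonneg_left h2' (inv_nonneg.2 hlam.le)
      have e1 : lam⁻¹ * (-(2 * lam * (z ⬝ᵥ Q.mulVec u))) = -2 * (z ⬝ᵥ Q.mulVec u) := by field_simp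
      have e2 : lam⁻¹ * (lam ^ 2 * (z ⬝ᵥ Q.mulVec z) + u ⬝ᵥ Q.mulVec u) =
          lam * (z ⬝ᵥ Q.mulVec z) + lam⁻¹ * (u ⬝ᵥ Q.mulVec u) := by field_simp
      rw [e1, e2] at h3
      linarith
    linarith
  · have h1' : 2 * lam * (z ⬝ᵥ Q.mulVec u) ≤ lam ^ 2 * (z ⬝ᵥ Q.mulVec z) + u ⬝ᵥ Q.mulVec u := by nlinarith
    have h3 : lam⁻¹ * (2 * lam * (z ⬝ᵥ Q.mulVec u)) ≤ lam⁻¹ * (lam ^ 2 * (z ⬝ᵥ Q.mulVec z) + u ⬝ᵥ Q.mulVec u) :=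
      mul_le_mul_of_nonneg_left h1' (inv_nonneg.2 hlam.le)
    have e1 : lam⁻¹ * (2 * lam * (z ⬝ᵥ Q.mulVec u)) = 2 * (z ⬝ᵥ Q.mulVec u) := by field_simp
    have e2 : lam⁻¹ * (lam ^ 2 * (z ⬝ᵥ Q.mulVec z) + u ⬝ᵥ Q.mulVec u) =
        lam * (z ⬝ᵥ Q.mulVec z) + lam⁻¹ * (u ⬝ᵥ Q.mulVec u) := by field_simp
    rw [e1, e2] at h3
    linarith

/-- **FORM-RELATIVE BOUND OF A SQUEEZED SYMMETRIC `D`**: if `⟨w,Dw⟩ ≤ K⟨w,P₀w⟩` and `−⟨w,Dw⟩ ≤ K⟨w,P₀w⟩` for all `w`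
(`P₀, D` symmetric, `K ≥ 0`), then `|⟨z,Du⟩| ≤ (K∕2)(λ⟨z,P₀z⟩ + λ⁻¹⟨u,P₀u⟩)` (`λ > 0`). [folklore] -/
theorem abs_dot_mulVec_le_of_squeeze (P₀ D : Matrix ι ι ℝ) (hP₀ : P₀.IsSymm) (hD : D.IsSymm) {K : ℝ}
    (hup : ∀ w, w ⬝ᵥ D.mulVec w ≤ K * (w ⬝ᵥ P₀.mulVec w)) (hlo : ∀ w, -(w ⬝ᵥ D.mulVec w) ≤ K * (w ⬝ᵥ P₀.mulVec w))
    {lam : ℝ} (hlam : 0 < lam) (z u : ι → ℝ) :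
    |z ⬝ᵥ D.mulVec u| ≤ K * (lam * (z ⬝ᵥ P₀.mulVec z) + lam⁻¹ * (u ⬝ᵥ P₀.mulVec u)) / 2 := by
  -- `Q₊ = K·P₀ − D` and `Q₋ = K·P₀ + D` are symmetric PSD
  have hQp : (K • P₀ - D).IsSymm := (hP₀.smul K).sub hD
  have hQm : (K • P₀ + D).IsSymm := (hP₀.smul K).add hD
  have hpsdp : ∀ w, 0 ≤ w ⬝ᵥ (K • P₀ - D).mulVec w := fun w => by
    have := hup w
    simp only [sub_mulVec, smul_mulVec, dotProduct_sub, dotProduct_smul, smul_eq_mul]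
    linarith
  have hpsdm : ∀ w, 0 ≤ w ⬝ᵥ (K • P₀ + D).mulVec w := fun w => by
    have := hlo w
    simp only [add_mulVec, smul_mulVec, dotProduct_add, dotProduct_smul, smul_eq_mul]
    linarith
  have hp := abs_dot_mulVec_le_of_psd (K • P₀ - D) hQp hpsdp hlam z u
  have hm := abs_dot_mulVec_le_of_psd (K • P₀ + D) hQm hpsdm hlam z u
  simp only [sub_mulVec, add_mulVec, smul_mulVec, dotProduct_sub, dotProduct_add, dotProduct_smul,
    smul_eq_mul] at hp hm
  -- `⟨z,Du⟩ = ½(⟨z,Q₋u⟩ − ⟨z,Q₊u⟩)`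
  set X : ℝ := K * (z ⬝ᵥ P₀.mulVec u) + z ⬝ᵥ D.mulVec u with hX
  set Y : ℝ := K * (z ⬝ᵥ P₀.mulVec u) - z ⬝ᵥ D.mulVec u with hY
  have habs : |z ⬝ᵥ D.mulVec u| ≤ (|X| + |Y|) / 2 := by
    have e : z ⬝ᵥ D.mulVec u = (X - Y) / 2 := by rw [hX, hY]; ring
    have h1 : |(X - Y) / 2| ≤ (|X| + |Y|) / 2 := by
      rw [abs_div, abs_two]
      exact div_le_div_of_nonneg_right (abs_sub X Y) (by norm_num)
    calc |z ⬝ᵥ D.mulVec u| = |(X - Y) / 2| := congrArg abs e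
      _ ≤ _ := h1
  refine habs.trans ?_
  have := add_le_add hm hp
  linarith

/-! ### §2 The line and its propagator: the form-relative `∂_s` letter -/

/-- coercivity of the line `L(r) = (1−r)P₀ + rP₁` from that of its endpoints (`r ∈ [0,1]`). [folklore] -/
theorem coercive_line (P₀ P₁ : Matrix ι ι ℝ) {σ : ℝ} (hP₀ : ∀ v, σ * (v ⬝ᵥ v) ≤ v ⬝ᵥ P₀.mulVec v)
    (hP₁ : ∀ v, σ * (v ⬝ᵥ v) ≤ v ⬝ᵥ P₁.mulVec v) {r : ℝ} (hr0 : 0 ≤ r) (hr1 : r ≤ 1) (v : ι → ℝ) :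
    σ * (v ⬝ᵥ v) ≤ v ⬝ᵥ ((1 - r) • P₀ + r • P₁).mulVec v := by
  have h0 := hP₀ v
  have h1 := hP₁ v
  simp only [add_mulVec, smul_mulVec, dotProduct_add, dotProduct_smul, smul_eq_mul]
  nlinarith

/-- the relative energy bound along the line: `c₁⟨v,P₀v⟩ ≤ ⟨v,P₁v⟩`, `0 ≤ ⟨v,P₀v⟩`, `c₁ ≤ 1` ⇒
`c₁⟨v,P₀v⟩ ≤ ⟨v,L(r)v⟩` for `r ∈ [0,1]`. [folklore] -/
theorem rel_energy_line (P₀ P₁ : Matrix ι ι ℝ) {c₁ : ℝ} (hc₁ : c₁ ≤ 1) (h0 : ∀ v, 0 ≤ v ⬝ᵥ P₀.mulVec v)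
    (hlow : ∀ v, c₁ * (v ⬝ᵥ P₀.mulVec v) ≤ v ⬝ᵥ P₁.mulVec v) {r : ℝ} (hr0 : 0 ≤ r) (hr1 : r ≤ 1) (v : ι → ℝ) :
    c₁ * (v ⬝ᵥ P₀.mulVec v) ≤ v ⬝ᵥ ((1 - r) • P₀ + r • P₁).mulVec v := by
  have h0v := h0 v
  have h1 := hlow v
  simp only [add_mulVec, smul_mulVec, dotProduct_add, dotProduct_smul, smul_eq_mul]
  have a1 : 0 ≤ (1 - r) * ((1 - c₁) * (v ⬝ᵥ P₀.mulVec v)) :=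
    mul_nonneg (by linarith) (mul_nonneg (by linarith) h0v)
  have a2 : r * (c₁ * (v ⬝ᵥ P₀.mulVec v)) ≤ r * (v ⬝ᵥ P₁.mulVec v) := mul_le_mul_of_nonneg_left h1 hr0
  nlinarith [a1, a2]

/-- **ENERGY-TO-NORM**: if `σ‖x‖² ≤ ⟨x, v⟩` (`σ > 0`) then `⟨x, v⟩ ≤ ‖v‖²∕σ` and `‖x‖² ≤ ‖v‖²∕σ²`. [folklore] -/
theorem dot_le_of_coercive_pair {σ : ℝ} (hσ : 0 < σ) (x v : ι → ℝ) (h : σ * (x ⬝ᵥ x) ≤ x ⬝ᵥ v) :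
    x ⬝ᵥ v ≤ (v ⬝ᵥ v) / σ ∧ x ⬝ᵥ x ≤ (v ⬝ᵥ v) / σ ^ 2 := by
  have hxx : 0 ≤ x ⬝ᵥ x := by
    simp only [dotProduct]; exact Finset.sum_nonneg fun _ _ => mul_self_nonneg _
  have hvv : 0 ≤ v ⬝ᵥ v := by
    simp only [dotProduct]; exact Finset.sum_nonneg fun _ _ => mul_self_nonneg _
  have hcs : (x ⬝ᵥ v) ^ 2 ≤ (x ⬝ᵥ x) * (v ⬝ᵥ v) := by
    simpa only [dotProduct, sq] using Finset.sum_mul_sq_le_sq_mul_sq (Finset.univ : Finset ι) x v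
  have hxv0 : 0 ≤ x ⬝ᵥ v := le_trans (mul_nonneg hσ.le hxx) h
  -- `σ²‖x‖⁴ ≤ ⟨x,v⟩² ≤ ‖x‖²‖v‖²` ⇒ `σ²‖x‖² ≤ ‖v‖²`
  have hx2 : σ ^ 2 * (x ⬝ᵥ x) ≤ v ⬝ᵥ v := by
    by_cases h0 : x ⬝ᵥ x = 0
    · rw [h0, mul_zero]; exact hvv
    · have hpos : 0 < x ⬝ᵥ x := lt_of_le_of_ne hxx (Ne.symm h0)
      have h4 : (σ * (x ⬝ᵥ x)) ^ 2 ≤ (x ⬝ᵥ x) * (v ⬝ᵥ v) :=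
        (pow_le_pow_left₀ (mul_nonneg hσ.le hxx) h 2).trans hcs
      nlinarith
  refine ⟨?_, ?_⟩
  · -- `⟨x,v⟩² ≤ ‖x‖²‖v‖² ≤ (‖v‖²∕σ)²`
    have h5 : (x ⬝ᵥ v) ^ 2 ≤ ((v ⬝ᵥ v) / σ) ^ 2 := by
      have : (x ⬝ᵥ x) * (v ⬝ᵥ v) ≤ ((v ⬝ᵥ v) / σ ^ 2) * (v ⬝ᵥ v) :=
        mul_le_mul_of_nonneg_right (by rw [le_div_iff₀ (by positivity)]; linarith) hvv
      calc (x ⬝ᵥ v) ^ 2 ≤ (x ⬝ᵥ x) * (v ⬝ᵥ v) := hcs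
        _ ≤ ((v ⬝ᵥ v) / σ ^ 2) * (v ⬝ᵥ v) := this
        _ = ((v ⬝ᵥ v) / σ) ^ 2 := by field_simp
    exact abs_le_of_sq_le_sq' h5 (by positivity) |>.2
  · rw [le_div_iff₀ (by positivity)]; linarith

/-- **THE `∂_s` LETTER IN FORM-RELATIVE CURRENCY.**  `P₀, P₁` symmetric, both `σ`-coercive (`σ > 0`); two-run
comparability `c₁⟨v,P₀v⟩ ≤ ⟨v,P₁v⟩` (`0 < c₁ ≤ 1`) and `|⟨v,P₁v⟩ − ⟨v,P₀v⟩| ≤ K⟨v,P₀v⟩` (`K > 0`); `L(r) = (1−r)P₀ + rP₁`.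
Then for all `s, t ∈ [0,1]` and every `g`: `‖(L(s)⁻¹ − L(t)⁻¹)g‖² ≤ (t−s)²·(K∕(c₁σ))²·‖g‖²` — no norm of `P₀`, `P₁`
enters. [folklore] -/
theorem inv_line_sub_inv_line_sq_le [DecidableEq ι] (P₀ P₁ : Matrix ι ι ℝ) (h0s : P₀.IsSymm) (h1s : P₁.IsSymm) {σ c₁ K : ℝ}
    (hσ : 0 < σ) (hc₁ : 0 < c₁) (hc₁' : c₁ ≤ 1) (hK : 0 < K)
    (hP₀ : ∀ v, σ * (v ⬝ᵥ v) ≤ v ⬝ᵥ P₀.mulVec v) (hP₁ : ∀ v, σ * (v ⬝ᵥ v) ≤ v ⬝ᵥ P₁.mulVec v)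
    (hlow : ∀ v, c₁ * (v ⬝ᵥ P₀.mulVec v) ≤ v ⬝ᵥ P₁.mulVec v)
    (hup : ∀ v, v ⬝ᵥ P₁.mulVec v - v ⬝ᵥ P₀.mulVec v ≤ K * (v ⬝ᵥ P₀.mulVec v))
    (hlo : ∀ v, v ⬝ᵥ P₀.mulVec v - v ⬝ᵥ P₁.mulVec v ≤ K * (v ⬝ᵥ P₀.mulVec v))
    {s t : ℝ} (hs0 : 0 ≤ s) (hs1 : s ≤ 1) (ht0 : 0 ≤ t) (ht1 : t ≤ 1) (g : ι → ℝ) :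
    (((1 - s) • P₀ + s • P₁)⁻¹ - ((1 - t) • P₀ + t • P₁)⁻¹).mulVec g ⬝ᵥ
        (((1 - s) • P₀ + s • P₁)⁻¹ - ((1 - t) • P₀ + t • P₁)⁻¹).mulVec g ≤
      (t - s) ^ 2 * (K / (c₁ * σ)) ^ 2 * (g ⬝ᵥ g) := by
  -- abbreviations and basic facts
  set Ls : Matrix ι ι ℝ := (1 - s) • P₀ + s • P₁ with hLs
  set Lt : Matrix ι ι ℝ := (1 - t) • P₀ + t • P₁ with hLt
  set D : Matrix ι ι ℝ := P₁ - P₀ with hDdef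
  have hP₀nn : ∀ v, 0 ≤ v ⬝ᵥ P₀.mulVec v := fun v => le_trans (mul_nonneg hσ.le (by
    simp only [dotProduct]; exact Finset.sum_nonneg fun _ _ => mul_self_nonneg _)) (hP₀ v)
  have hcoer_s : ∀ v, σ * (v ⬝ᵥ v) ≤ v ⬝ᵥ Ls.mulVec v := coercive_line P₀ P₁ hP₀ hP₁ hs0 hs1
  have hcoer_t : ∀ v, σ * (v ⬝ᵥ v) ≤ v ⬝ᵥ Lt.mulVec v := coercive_line P₀ P₁ hP₀ hP₁ ht0 ht1
  have hdet_s : IsUnit Ls.det := isUnit_det_of_coercive Ls hσ hcoer_s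
  have hdet_t : IsUnit Lt.det := isUnit_det_of_coercive Lt hσ hcoer_t
  have hLs_symm : Ls.IsSymm := (h0s.smul (1 - s)).add (h1s.smul s)
  have hD_symm : D.IsSymm := h1s.sub h0s
  have hGs_symm : (Ls⁻¹).IsSymm := hLs_symm.inv
  -- the three vectors
  set u : ι → ℝ := Lt⁻¹.mulVec g with hu
  set w : ι → ℝ := Ls⁻¹.mulVec (D.mulVec u) with hw
  set z : ι → ℝ := Ls⁻¹.mulVec w with hz
  -- the identity `(Gs − Gt)g = (t − s)•w`
  have hsub : Lt - Ls = (t - s) • D := by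
    simp only [hLs, hLt, hDdef, smul_sub, sub_smul, one_smul]; abel
  have hident : (Ls⁻¹ - Lt⁻¹).mulVec g = (t - s) • w := by
    have key : Ls⁻¹ * (Lt - Ls) * Lt⁻¹ = Ls⁻¹ - Lt⁻¹ := by
      rw [Matrix.mul_sub, Matrix.sub_mul, Matrix.mul_assoc _ Lt, mul_nonsing_inv _ hdet_t, Matrix.mul_one,
        nonsing_inv_mul _ hdet_s, Matrix.one_mul]
    rw [← key, hsub, Matrix.mul_smul, Matrix.smul_mul, smul_mulVec, ← mulVec_mulVec, ← mulVec_mulVec]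
  -- solved equations
  have hLu : Lt.mulVec u = g := by rw [hu, mulVec_mulVec, mul_nonsing_inv _ hdet_t, one_mulVec]
  have hLw : Ls.mulVec w = D.mulVec u := by rw [hw, mulVec_mulVec, mul_nonsing_inv _ hdet_s, one_mulVec]
  have hLz : Ls.mulVec z = w := by rw [hz, mulVec_mulVec, mul_nonsing_inv _ hdet_s, one_mulVec]
  -- (a) `‖w‖² = ⟨z, Du⟩`
  have hww : w ⬝ᵥ w = z ⬝ᵥ D.mulVec u := by
    rw [show w ⬝ᵥ w = w ⬝ᵥ Ls⁻¹.mulVec (D.mulVec u) by rw [hw],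
      dot_mulVec_comm_of_isSymm Ls⁻¹ hGs_symm w (D.mulVec u), dotProduct_comm, ← hz]
  -- (b) energies along the line: `⟨z,P₀z⟩ ≤ ‖w‖²∕(c₁σ)`, `⟨u,P₀u⟩ ≤ ‖g‖²∕(c₁σ)`
  have hzw : z ⬝ᵥ w ≤ (w ⬝ᵥ w) / σ := by
    have h := hcoer_s z
    rw [hLz] at h
    exact (dot_le_of_coercive_pair hσ z w h).1
  have hug : u ⬝ᵥ g ≤ (g ⬝ᵥ g) / σ := by
    have h := hcoer_t u
    rw [hLu] at h
    exact (dot_le_of_coercive_pair hσ u g h).1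
  have hEz : z ⬝ᵥ P₀.mulVec z ≤ (w ⬝ᵥ w) / (c₁ * σ) := by
    have h := rel_energy_line P₀ P₁ hc₁' hP₀nn hlow hs0 hs1 z
    rw [← hLs, hLz] at h
    rw [le_div_iff₀ (by positivity)]
    calc z ⬝ᵥ P₀.mulVec z * (c₁ * σ) = σ * (c₁ * (z ⬝ᵥ P₀.mulVec z)) := by ring
      _ ≤ σ * (z ⬝ᵥ w) := mul_le_mul_of_nonneg_left h hσ.le
      _ ≤ σ * ((w ⬝ᵥ w) / σ) := mul_le_mul_of_nonneg_left hzw hσ.le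
      _ = w ⬝ᵥ w := by field_simp
  have hEu : u ⬝ᵥ P₀.mulVec u ≤ (g ⬝ᵥ g) / (c₁ * σ) := by
    have h := rel_energy_line P₀ P₁ hc₁' hP₀nn hlow ht0 ht1 u
    rw [← hLt, hLu] at h
    rw [le_div_iff₀ (by positivity)]
    calc u ⬝ᵥ P₀.mulVec u * (c₁ * σ) = σ * (c₁ * (u ⬝ᵥ P₀.mulVec u)) := by ring
      _ ≤ σ * (u ⬝ᵥ g) := mul_le_mul_of_nonneg_left h hσ.le
      _ ≤ σ * ((g ⬝ᵥ g) / σ) := mul_le_mul_of_nonneg_left hug hσ.le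
      _ = g ⬝ᵥ g := by field_simp
  -- (c) the squeeze with `λ = c₁σ∕K`
  have hupD : ∀ v, v ⬝ᵥ D.mulVec v ≤ K * (v ⬝ᵥ P₀.mulVec v) := fun v => by
    have := hup v; simp only [hDdef, sub_mulVec, dotProduct_sub]; linarith
  have hloD : ∀ v, -(v ⬝ᵥ D.mulVec v) ≤ K * (v ⬝ᵥ P₀.mulVec v) := fun v => by
    have := hlo v; simp only [hDdef, sub_mulVec, dotProduct_sub]; linarith
  have hlam : 0 < c₁ * σ / K := by positivity
  have hsq := abs_dot_mulVec_le_of_squeeze P₀ D h0s hD_symm hupD hloD hlam z u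
  have hww' : w ⬝ᵥ w ≤ K * ((c₁ * σ / K) * ((w ⬝ᵥ w) / (c₁ * σ)) + (c₁ * σ / K)⁻¹ * ((g ⬝ᵥ g) / (c₁ * σ))) / 2 := by
    have h1 : (c₁ * σ / K) * (z ⬝ᵥ P₀.mulVec z) ≤ (c₁ * σ / K) * ((w ⬝ᵥ w) / (c₁ * σ)) :=
      mul_le_mul_of_nonneg_left hEz hlam.le
    have h2 : (c₁ * σ / K)⁻¹ * (u ⬝ᵥ P₀.mulVec u) ≤ (c₁ * σ / K)⁻¹ * ((g ⬝ᵥ g) / (c₁ * σ)) :=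
      mul_le_mul_of_nonneg_left hEu (inv_nonneg.2 hlam.le)
    have h3 := mul_le_mul_of_nonneg_left (add_le_add h1 h2) hK.le
    calc w ⬝ᵥ w = z ⬝ᵥ D.mulVec u := hww
      _ ≤ |z ⬝ᵥ D.mulVec u| := le_abs_self _
      _ ≤ _ := hsq
      _ ≤ _ := by linarith
  have hwfinal : w ⬝ᵥ w ≤ (K / (c₁ * σ)) ^ 2 * (g ⬝ᵥ g) := by
    have e : K * ((c₁ * σ / K) * ((w ⬝ᵥ w) / (c₁ * σ)) + (c₁ * σ / K)⁻¹ * ((g ⬝ᵥ g) / (c₁ * σ))) / 2 =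
        (w ⬝ᵥ w) / 2 + (K / (c₁ * σ)) ^ 2 * (g ⬝ᵥ g) / 2 := by
      field_simp
    rw [e] at hww'
    linarith
  -- (d) assemble
  rw [hident, smul_dotProduct, dotProduct_smul, smul_eq_mul, smul_eq_mul]
  have hts : 0 ≤ (t - s) ^ 2 := sq_nonneg _
  calc (t - s) * ((t - s) * (w ⬝ᵥ w)) = (t - s) ^ 2 * (w ⬝ᵥ w) := by ring
    _ ≤ (t - s) ^ 2 * ((K / (c₁ * σ)) ^ 2 * (g ⬝ᵥ g)) := mul_le_mul_of_nonneg_left hwfinal hts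
    _ = (t - s) ^ 2 * (K / (c₁ * σ)) ^ 2 * (g ⬝ᵥ g) := by ring

end Abstract

/-! ### §2b The same for the interpolated-Schur line `lineOpR` (`P₁ = A₁ − BD⁻¹C`) -/

section SchurLine

variable {ιc ιf : Type*} [Fintype ιc] [Fintype ιf] [DecidableEq ιc] [DecidableEq ιf]

/-- **THE FORM-RELATIVE `∂_s` LETTER FOR THE INTERPOLATED-SCHUR LINE** `G(s) = lineOpR⁻¹`: with `P₁ = A₁ − BD⁻¹C`
symmetric, `P₀, P₁` `σ`-coercive and two-run comparable (`c₁P₀ ≤ P₁`, `|P₁ − P₀| ≤ K·P₀` as forms):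
`‖(G(s) − G(t))g‖² ≤ (t−s)²(K∕(c₁σ))²‖g‖²` for all `s, t ∈ [0,1]`. [folklore] -/
theorem lineOpR_inv_sub_inv_rel (P₀ A₁ : Matrix ιc ιc ℝ) (B : Matrix ιc ιf ℝ) (C : Matrix ιf ιc ℝ) (D : Matrix ιf ιf ℝ)
    (h0s : P₀.IsSymm) (h1s : (A₁ - B * D⁻¹ * C).IsSymm) {σ c₁ K : ℝ} (hσ : 0 < σ) (hc₁ : 0 < c₁) (hc₁' : c₁ ≤ 1)
    (hK : 0 < K) (hP₀ : ∀ v, σ * (v ⬝ᵥ v) ≤ v ⬝ᵥ P₀.mulVec v)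
    (hP₁ : ∀ v, σ * (v ⬝ᵥ v) ≤ v ⬝ᵥ (A₁ - B * D⁻¹ * C).mulVec v)
    (hlow : ∀ v, c₁ * (v ⬝ᵥ P₀.mulVec v) ≤ v ⬝ᵥ (A₁ - B * D⁻¹ * C).mulVec v)
    (hup : ∀ v, v ⬝ᵥ (A₁ - B * D⁻¹ * C).mulVec v - v ⬝ᵥ P₀.mulVec v ≤ K * (v ⬝ᵥ P₀.mulVec v))
    (hlo : ∀ v, v ⬝ᵥ P₀.mulVec v - v ⬝ᵥ (A₁ - B * D⁻¹ * C).mulVec v ≤ K * (v ⬝ᵥ P₀.mulVec v))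
    {s t : ℝ} (hs0 : 0 ≤ s) (hs1 : s ≤ 1) (ht0 : 0 ≤ t) (ht1 : t ≤ 1) (g : ιc → ℝ) :
    ((lineOpR P₀ A₁ B C D s)⁻¹ - (lineOpR P₀ A₁ B C D t)⁻¹).mulVec g ⬝ᵥ
        ((lineOpR P₀ A₁ B C D s)⁻¹ - (lineOpR P₀ A₁ B C D t)⁻¹).mulVec g ≤
      (t - s) ^ 2 * (K / (c₁ * σ)) ^ 2 * (g ⬝ᵥ g) :=
  inv_line_sub_inv_line_sq_le P₀ (A₁ - B * D⁻¹ * C) h0s h1s hσ hc₁ hc₁' hK hP₀ hP₁ hlow hup hlo hs0 hs1 ht0 ht1 g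

end SchurLine

/-! ### §3 The located fact at U = 1: the Schur-test constant of run A is at least `n²` -/

section U1

open Literature.MathematicalPhysics.QuantumFieldTheory.Balaban1983to89
open Literature.MathematicalPhysics.QuantumFieldTheory.Balaban1983to89.B4Reflection242
open Literature.MathematicalPhysics.QuantumFieldTheory.Balaban1983to89.B4Lower18
open NE7K1LinSchurLineU1

variable {d n L : ℕ} {R' : Finset (Fin (d + 1) → ℤ)}

/-- the diagonal entry of run A's operator: `(runA)_{xx} = n²·deg_R(x) + a∕n^{d+1}`. [folklore] -/
theorem runA_apply_self (a : ℝ) (x : ↥(R'.image (blk L))) :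
    runA n L a R' x x = (n : ℝ) ^ 2 * ((((nbrs x.1).filter fun z => z ∈ R'.image (blk L)).card : ℕ) : ℝ) +
      a * ((n : ℝ) ^ (d + 1))⁻¹ := by
  simp only [runA, fineOpR, regionOpR, Matrix.of_apply, neumannLapR, diagK, avgK, if_true, zero_add]

/-- `wN` at weight `0` is the squared `ℓ²` norm. [folklore] -/
theorem wN_zero {ι : Type*} [Fintype ι] (v : ι → ℝ) : wN (fun _ : ι => (0 : ℝ)) v = ∑ i, v i ^ 2 := by
  simp only [wN, Real.exp_zero, one_mul]

/-- **THE SCHUR-TEST CONSTANT OF RUN A IS MESH-DEPENDENT**: if `‖P_A w‖² ≤ K_{P₀}²‖w‖²` for all `w` (the `hKP`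
hypothesis of `NE7K1LinSchurLineDeriv.wN_lineOpR_inv_sub_inv_le` at weight `0`) and the region has a nearest-neighbour
pair, then `n⁴ ≤ K_{P₀}²` (`a ≥ 0`; test on `w = δ_x`). [folklore] -/
theorem schurTest_runA_ge {a : ℝ} (ha : 0 ≤ a) {KP : ℝ}
    (hKP : ∀ w, wN (fun _ => (0 : ℝ)) ((runA n L a R').mulVec w) ≤ KP ^ 2 * wN (fun _ => (0 : ℝ)) w)
    {x y : ↥(R'.image (blk L))} (hxy : y.1 ∈ nbrs x.1) : ((n : ℝ) ^ 2) ^ 2 ≤ KP ^ 2 := by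
  classical
  have h := hKP (Pi.single x 1)
  rw [wN_zero, wN_zero] at h
  have hδ : ∑ i, (Pi.single x (1 : ℝ) : ↥(R'.image (blk L)) → ℝ) i ^ 2 = 1 := by
    rw [Finset.sum_eq_single x (fun i _ hi => by rw [Pi.single_eq_of_ne hi, zero_pow two_ne_zero])
      (fun h => absurd (Finset.mem_univ _) h), Pi.single_eq_same, one_pow]
  rw [hδ, mul_one] at h
  have hdiag : ((runA n L a R').mulVec (Pi.single x 1)) x = runA n L a R' x x := by
    rw [mulVec_single_one, Matrix.col_apply]
  have hx : (runA n L a R' x x) ^ 2 ≤ ∑ i, ((runA n L a R').mulVec (Pi.single x 1)) i ^ 2 := by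
    rw [← hdiag]
    exact Finset.single_le_sum (f := fun i => ((runA n L a R').mulVec (Pi.single x 1)) i ^ 2)
      (fun i _ => sq_nonneg _) (Finset.mem_univ x)
  have hcard : 1 ≤ ((nbrs x.1).filter fun z => z ∈ R'.image (blk L)).card :=
    Finset.card_pos.2 ⟨y.1, Finset.mem_filter.2 ⟨hxy, y.2⟩⟩
  have hge : (n : ℝ) ^ 2 ≤ runA n L a R' x x := by
    rw [runA_apply_self]
    have h1 : (1 : ℝ) ≤ ((((nbrs x.1).filter fun z => z ∈ R'.image (blk L)).card : ℕ) : ℝ) := by exact_mod_cast hcard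
    have h2 : 0 ≤ a * ((n : ℝ) ^ (d + 1))⁻¹ := by positivity
    nlinarith [sq_nonneg (n : ℝ)]
  calc ((n : ℝ) ^ 2) ^ 2 ≤ (runA n L a R' x x) ^ 2 := pow_le_pow_left₀ (by positivity) hge 2
    _ ≤ _ := hx
    _ ≤ KP ^ 2 := h

end U1

end Summit.QuantumFields.BalabanUV.T4Continuum.NE7K1LinSchurLineDerivRel
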